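import Summits.PneNP.PneNP.Theorems.SzkEntropyPeaThreeNotInPTensorIsoDefs
import Mathlib.Algebra.BigOperators.Ring.List
import Mathlib.Data.Fin.Tuple.Basic

/-!
# Route SzkEntropy, crux `PeaThreeNotInP` (stmt-PneNP-10776), line `SketchIdeator3`: stub
# `stub_semantics` — semantics of the sparse orbit map and of the mixture map

For tensors `S T : Tensor3 a b c` over `F₂`:

* `orbitMap T` is a cubic sparse map (`DegLE 3`) and `mixMap S T` has degree `≤ 4` (`DegLE 4`)
  — every monomial is `mono o p` (three variable indices), shifted by `Fin.castSucc` and possibly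
  prefixed by the selector variable `Fin.last`;
* `(orbitMap T).eval v = flattenList (tensorAct (readTriple v) T)` (`eval_orbitMap`): output
  `(i,(j,k))` is
  `∑_{(i',(j',k')) ∈ supp T} A i i' B j j' C k k' = (A · T · (B ⊗ C)ᵀ)_{i,(j,k)}`;
* `(mixMap S T).eval w = flattenList (mixSampler S T (sel, readTriple w|))` (`eval_mixMap`): the
  value `(M·T)_o + sel · (M·(S+T))_o` is `(M·S)_o` for `sel = 1` and `(M·T)_o` for `sel = 0`;
* hence, `flattenList` being injective and `readTriple` (resp. `w ↦ (sel, readTriple w|)`) being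
  a bijection onto `Triple a b c` (resp. `Bool × Triple a b c`), the output entropies are
  `(orbitMap T).entropy = samplerEntropy T` and `(mixMap S T).entropy = mixEntropy S T`
  (`mapEntropy_comp_of_injOn`, `mapEntropy_univ_comp_equiv`).

[card tensor-orbit-two-query, S1; card tensor-iso-monoid-import]
-/

noncomputable section

open Finset Matrix
open scoped Kronecker
open _root_.Computability Literature.InformationTheory.Entropy Literature.Computability.Complexity

namespace Summit.PneNP.PneNP.Cruxes.PeaThreeNotInP.TensorIsoLine

set_option linter.dupNamespace false -- `Summit.PneNP.PneNP.…`: summit = sub-problem name (D-0017 single-conjunct layout)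

variable {a b c : ℕ}

/-! ### Degree bounds -/

/-- Every monomial of the orbit map lists exactly three variables. [card tensor-orbit-two-query] -/
theorem degLE_orbitMap (T : Tensor3 a b c) : (orbitMap T).DegLE 3 := by
  intro p hp μ hμ
  obtain ⟨o, -, rfl⟩ := List.mem_map.1 hp
  obtain ⟨q, -, rfl⟩ := List.mem_map.1 hμ
  simp [mono]

/-- Every monomial of the mixture map lists three or four variables.
[card tensor-iso-monoid-import] -/
theorem degLE_mixMap (S T : Tensor3 a b c) : (mixMap S T).DegLE 4 := by
  intro p hp μ hμ
  obtain ⟨o, -, rfl⟩ := List.mem_map.1 hp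
  rcases List.mem_append.1 hμ with h | h
  · obtain ⟨q, -, rfl⟩ := List.mem_map.1 h
    simp [mono]
  · obtain ⟨q, -, rfl⟩ := List.mem_map.1 h
    simp [mono]

/-! ### Evaluation of the orbit map -/

/-- The output index list has no duplicates. [folklore] -/
theorem nodup_outIdx (a b c : ℕ) : (outIdx a b c).Nodup :=
  (List.nodup_finRange a).product ((List.nodup_finRange b).product (List.nodup_finRange c))

/-- Every output position occurs in the output index list. [folklore] -/
theorem mem_outIdx (p : Fin a × (Fin b × Fin c)) : p ∈ outIdx a b c := by
  obtain ⟨i, j, k⟩ := p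
  simp [outIdx, List.mem_finRange]

/-- The output index list enumerates the whole index type. [folklore] -/
theorem toFinset_outIdx (a b c : ℕ) : (outIdx a b c).toFinset = Finset.univ :=
  Finset.eq_univ_iff_forall.2 fun p => List.mem_toFinset.2 (mem_outIdx p)

/-- Summing over a filtered list is summing the indicator-weighted terms over the list.
[folklore] -/
theorem sum_map_filter {α M : Type*} [AddMonoid M] (l : List α) (P : α → Bool) (g : α → M) :
    ((l.filter P).map g).sum = (l.map fun x => if P x then g x else 0).sum := by
  induction l with
  | nil => simp
  | cons x l ih => cases h : P x <;> simp [h, ih]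

/-- Over `F₂`, the indicator of `t = 1` times `x` is `t * x`. [folklore] -/
theorem ite_eq_one_eq_mul (t x : ZMod 2) : (if t = 1 then x else 0) = t * x := by
  revert t x
  decide

/-- Entry formula of the trilinear action:
`((A,B,C)·X)_{i,(j,k)} = ∑_{(i',(j',k'))} X_{i',(j',k')} · (A i i' · (B j j' · C k k'))`.
[GrochowQiao2023, §2] -/
theorem tensorAct_apply (M : Triple a b c) (X : Tensor3 a b c) (i : Fin a) (jk : Fin b × Fin c) :
    tensorAct M X i jk =
      ∑ p : Fin a × (Fin b × Fin c),
        X p.1 p.2 * (M.1 i p.1 * (M.2.1 jk.1 p.2.1 * M.2.2 jk.2 p.2.2)) := by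
  simp only [tensorAct, Matrix.mul_apply, Matrix.transpose_apply, Matrix.kroneckerMap_apply,
    Finset.sum_mul]
  rw [Finset.sum_comm, Fintype.sum_prod_type]
  refine Finset.sum_congr rfl fun i' _ => Finset.sum_congr rfl fun q _ => ?_
  ring

/-- **The output polynomial at position `o` of the orbit map evaluates to `(M·X)_o`** with
`M = readTriple v`:
`∑_{p ∈ supp X} A_{o₁ p₁} B_{o₂ p₂} C_{o₃ p₃} = ∑_p X_p · A_{o₁ p₁} B_{o₂ p₂} C_{o₃ p₃}`
(a sum over all positions `p`).
[card tensor-orbit-two-query, S1] -/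
theorem sum_suppList (X : Tensor3 a b c) (v : Fin (nvars a b c) → ZMod 2)
    (o : Fin a × (Fin b × Fin c)) :
    ((suppList X).map fun p => ((mono o p).map v).prod).sum =
      tensorAct (readTriple v) X o.1 o.2 := by
  rw [suppList, sum_map_filter, ← List.sum_toFinset _ (nodup_outIdx a b c), toFinset_outIdx,
    tensorAct_apply]
  refine Finset.sum_congr rfl fun p _ => ?_
  simp [mono, readTriple, ite_eq_one_eq_mul]

/-- **Semantics of the orbit map**: its value at a valuation `v` is the flattened tensor
`(readTriple v)·T`. [card tensor-orbit-two-query, S1] -/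
theorem eval_orbitMap (T : Tensor3 a b c) (v : Fin (nvars a b c) → ZMod 2) :
    (orbitMap T).eval v = flattenList (tensorAct (readTriple v) T) := by
  simp only [PolyMapF2.eval, orbitMap, flattenList, List.map_map, Function.comp_def,
    sum_suppList]

/-! ### Evaluation of the mixture map -/

/-- The action is additive in the tensor. [GrochowQiao2023, §2] -/
theorem tensorAct_add (M : Triple a b c) (S T : Tensor3 a b c) :
    tensorAct M (S + T) = tensorAct M S + tensorAct M T := by
  simp [tensorAct, Matrix.mul_add, Matrix.add_mul]

/-- Over `F₂`: `t + sel · (s + t)` is `s` if `sel = 1` and `t` otherwise. [folklore] -/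
theorem add_mul_add_eq_ite (sel s t : ZMod 2) :
    t + sel * (s + t) = if sel = 1 then s else t := by
  revert sel s t
  decide

/-- **Semantics of the mixture map**: its value at `w` is the flattened tensor `M·S` if the
selector `w (Fin.last _)` is `1` and `M·T` otherwise, `M = readTriple (w ∘ Fin.castSucc)`.
[card tensor-iso-monoid-import] -/
theorem eval_mixMap (S T : Tensor3 a b c) (w : Fin (nvars a b c + 1) → ZMod 2) :
    (mixMap S T).eval w = flattenList (mixSampler S T
      (decide (w (Fin.last (nvars a b c)) = 1), readTriple fun i => w (Fin.castSucc i))) := by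
  simp only [PolyMapF2.eval, mixMap, flattenList, List.map_map, Function.comp_def,
    List.map_append, List.sum_append, List.map_cons, List.prod_cons, List.sum_map_mul_left,
    sum_suppList, tensorAct_add, Matrix.add_apply, add_mul_add_eq_ite, mixSampler,
    decide_eq_true_eq]
  refine List.map_congr_left fun o _ => ?_
  split_ifs <;> rfl

/-! ### Injectivity of the flattening and the re-indexing bijections -/

/-- Flattening a tensor to the list of its entries is injective. [folklore] -/
theorem flattenList_injective :
    Function.Injective (flattenList : Tensor3 a b c → List (ZMod 2)) := by
  intro U U' h
  ext i jk
  exact List.map_inj_left.1 h (i, jk) (mem_outIdx (i, jk))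

/-- `readTriple` is a bijection from valuations of the `a² + b² + c²` variables onto matrix
triples. [folklore] -/
theorem exists_equiv_readTriple (a b c : ℕ) :
    ∃ e : (Fin (nvars a b c) → ZMod 2) ≃ Triple a b c, ∀ v, e v = readTriple v := by
  refine ⟨{ toFun := readTriple
            invFun := fun M => Fin.append (Fin.append
              (fun x => M.1 (finProdFinEquiv.symm x).1 (finProdFinEquiv.symm x).2)
              (fun x => M.2.1 (finProdFinEquiv.symm x).1 (finProdFinEquiv.symm x).2))
              (fun x => M.2.2 (finProdFinEquiv.symm x).1 (finProdFinEquiv.symm x).2)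
            left_inv := fun v => ?_
            right_inv := fun M => ?_ }, fun v => rfl⟩
  · funext x
    induction x using Fin.addCases with
    | left y =>
      induction y using Fin.addCases with
      | left z =>
        simp only [Fin.append_left, readTriple, varA, Matrix.of_apply, Prod.mk.eta,
          Equiv.apply_symm_apply]
      | right z =>
        simp only [Fin.append_left, Fin.append_right, readTriple, varB, Matrix.of_apply,
          Prod.mk.eta, Equiv.apply_symm_apply]
    | right y =>
      simp only [Fin.append_right, readTriple, varC, Matrix.of_apply, Prod.mk.eta,
        Equiv.apply_symm_apply]
  · obtain ⟨A, B, C⟩ := M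
    refine Prod.ext ?_ (Prod.ext ?_ ?_)
    · ext i i'
      simp only [readTriple, varA, Matrix.of_apply, Fin.append_left, Equiv.symm_apply_apply]
    · ext j j'
      simp only [readTriple, varB, Matrix.of_apply, Fin.append_left, Fin.append_right,
        Equiv.symm_apply_apply]
    · ext k k'
      simp only [readTriple, varC, Matrix.of_apply, Fin.append_right, Equiv.symm_apply_apply]

/-- `w ↦ (w (Fin.last _) = 1, readTriple (w ∘ Fin.castSucc))` is a bijection from valuations of
the `a² + b² + c² + 1` variables onto `Bool × Triple a b c`. [folklore] -/
theorem exists_equiv_mix (a b c : ℕ) :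
    ∃ e : (Fin (nvars a b c + 1) → ZMod 2) ≃ Bool × Triple a b c,
      ∀ w, e w =
        (decide (w (Fin.last (nvars a b c)) = 1), readTriple fun i => w (Fin.castSucc i)) := by
  obtain ⟨e₁, he₁⟩ := exists_equiv_readTriple a b c
  refine ⟨{ toFun := fun w =>
              (decide (w (Fin.last (nvars a b c)) = 1), e₁ fun i => w (Fin.castSucc i))
            invFun := fun p => Fin.snoc (e₁.symm p.2) (if p.1 then 1 else 0)
            left_inv := fun w => ?_
            right_inv := fun p => ?_ }, fun w => by simp [he₁]⟩
  · have hsel : ∀ x : ZMod 2, (if x = 1 then (1 : ZMod 2) else 0) = x := by decide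
    funext x
    induction x using Fin.lastCases with
    | last => simp [hsel]
    | cast i => simp
  · obtain ⟨β, M⟩ := p
    cases β <;> simp

/-! ### The entropies -/

/-- **The orbit map has the sampler's output entropy**: `H(orbitMap T (U)) = H(M·T)`, `M` a
uniform triple. [card tensor-orbit-two-query, S1] -/
theorem entropy_orbitMap (T : Tensor3 a b c) : (orbitMap T).entropy = samplerEntropy T := by
  obtain ⟨e, he⟩ := exists_equiv_readTriple a b c
  have h1 : (orbitMap T).eval = flattenList ∘ (sampler T ∘ e) := by
    funext v
    simp [eval_orbitMap, he, sampler]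
  unfold PolyMapF2.entropy samplerEntropy
  rw [h1, Literature.InformationTheory.Entropy.mapEntropy_comp_of_injOn _ _
      fun x _ y _ h => flattenList_injective h,
    Literature.InformationTheory.Entropy.mapEntropy_univ_comp_equiv]

/-- **The mixture map has the mixture's output entropy**: `H(mixMap S T (U)) = H(mixSampler S T)`.
[card tensor-iso-monoid-import] -/
theorem entropy_mixMap (S T : Tensor3 a b c) : (mixMap S T).entropy = mixEntropy S T := by
  obtain ⟨e, he⟩ := exists_equiv_mix a b c
  have h1 : (mixMap S T).eval = flattenList ∘ (mixSampler S T ∘ e) := by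
    funext w
    simp [eval_mixMap, he]
  unfold PolyMapF2.entropy mixEntropy
  rw [h1, Literature.InformationTheory.Entropy.mapEntropy_comp_of_injOn _ _
      fun x _ y _ h => flattenList_injective h,
    Literature.InformationTheory.Entropy.mapEntropy_univ_comp_equiv]

/-! ### The registered stub -/

/-- **stub_semantics** (P1): the sparse orbit map is cubic and its output entropy is the sampler
entropy; the mixture map has degree `4` and its output entropy is the mixture entropy (evaluation =
flattened `tensorAct` of the matrices read off the valuation; re-indexing and an injective
post-composition). [card tensor-orbit-two-query, S1; card tensor-iso-monoid-import] -/
theorem stub_semantics {a b c : ℕ} (S T : Tensor3 a b c) :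
    (orbitMap T).DegLE 3 ∧ (orbitMap T).entropy = samplerEntropy T ∧
      (mixMap S T).DegLE 4 ∧ (mixMap S T).entropy = mixEntropy S T :=
  ⟨degLE_orbitMap T, entropy_orbitMap T, degLE_mixMap S T, entropy_mixMap S T⟩

end Summit.PneNP.PneNP.Cruxes.PeaThreeNotInP.TensorIsoLine

end
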